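import Mathlib
import HarnessLib
import Literature.Probability.RandomPlanarGeometry.ImageUnivalent
import Literature.Probability.RandomPlanarGeometry.BallMoebius
import Literature.Probability.RandomPlanarGeometry.ConformalMapRiemannProofs
import Literature.Probability.RandomPlanarGeometry.JordanDomainProofs

/-!
# Werner determination (route SAWLoopLift, item stmt-CriticalPhenomena-4851) — Riemann maps and
exhaustion of simply connected domains by Jordan domains

Helper file (`--supports stmt-CriticalPhenomena-4851`). The hypotheses of the route item
`WernerDetermination` give the masses of the events `{T ⊆ U, T surrounds z, T ⊄ V}` only for JORDAN
domains `V ⊆ U` and only through Riemann maps `φ : 𝔻 → U`, `ψ : 𝔻 → V` centred at `z`. This file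
supplies, from the tree's Riemann mapping theorem (`exists_conformalEquiv_ball_apply_eq_zero`) and the
simple connectivity of Jordan domains (`JordanDomain.isSimplyConnected_carrier`):

* `exists_conformalEquiv_ball_apply_zero` — a centred Riemann map `𝔻 → U` onto any simply connected
  bounded domain (in particular onto a Jordan domain, `JordanDomain.exists_conformalEquiv_apply_zero`);
* `exists_jordanDomain_carrier_eq_ball` — round discs `ball c ρ` are carriers of Jordan domains;
* `exists_jordanDomain_exhaustion` — a bounded simply connected domain `C ∋ q` is an increasing union of
  (carriers of) Jordan domains containing `q`, images of concentric discs under the Riemann map, such that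
  every compact subset of `C` lies in one of them (Werner 2008, proof of Lemma 4: "exhaust simply
  connected domains by Jordan subdomains").

No new definitions (existence statements only). References: W. Werner, J. Amer. Math. Soc. 21 (2008),
§3; L. V. Ahlfors, *Complex Analysis* (1979), Ch. 6 §1.1.
-/

noncomputable section

namespace Summit.CriticalPhenomena.SAWScalingLimit.Theorems.WernerDetermination

open Set Metric Bornology Topology Filter
open Literature.Probability.RandomPlanarGeometry

/-! ### Centred Riemann maps -/

/-- **Centred Riemann map onto a bounded simply connected domain**: for `C ⊆ ℂ` open, simply connected,
bounded and `q ∈ C` there is a conformal equivalence `φ : 𝔻 → C` with `φ 0 = q` (the inverse of the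
Riemann map `C → 𝔻` vanishing at `q`). Ahlfors (1979), Ch. 6 §1.1, Thm. 1. [folklore] -/
theorem exists_conformalEquiv_ball_apply_zero {C : Set ℂ} (hCo : IsOpen C) (hsc : IsSimplyConnected C)
    (hCb : IsBounded C) {q : ℂ} (hq : q ∈ C) :
    ∃ φ : ConformalEquiv (ball (0 : ℂ) 1) C, φ 0 = q := by
  have hne : C ≠ univ := fun h => NormedSpace.unbounded_univ ℝ ℂ (h ▸ hCb)
  obtain ⟨φ₀, hφ₀⟩ := exists_conformalEquiv_ball_apply_eq_zero hCo hsc hne hq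
  refine ⟨φ₀.symm, ?_⟩
  have h := φ₀.symm_apply_apply hq
  rw [hφ₀] at h
  exact h

/-- **Centred Riemann map onto a Jordan domain**: for a Jordan domain `U` and `z ∈ U` there is a
conformal equivalence `φ : 𝔻 → U` with `φ 0 = z`. [folklore] -/
theorem JordanDomain.exists_conformalEquiv_apply_zero (U : JordanDomain) {z : ℂ} (hz : z ∈ U.carrier) :
    ∃ φ : ConformalEquiv (ball (0 : ℂ) 1) U.carrier, φ 0 = z :=
  exists_conformalEquiv_ball_apply_zero U.isOpen U.isSimplyConnected_carrier U.isBounded hz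

/-! ### Round discs -/

/-- **Round discs are Jordan domains**: for `0 < ρ` there is a Jordan domain with carrier `ball c ρ`
(the translate of `JordanDomain.disc ρ`). [folklore] -/
theorem exists_jordanDomain_carrier_eq_ball (c : ℂ) {ρ : ℝ} (hρ : 0 < ρ) :
    ∃ V : JordanDomain, V.carrier = ball c ρ := by
  refine ⟨(JordanDomain.disc ρ hρ).image (fun w => w + c) (by fun_prop)
    (fun x _ y _ h => by simpa using h), ?_⟩
  rw [JordanDomain.carrier_image, JordanDomain.carrier_disc]
  ext w
  simp only [mem_image, mem_ball, dist_zero_right]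
  constructor
  · rintro ⟨x, hx, rfl⟩
    simpa [dist_eq_norm] using hx
  · intro hw
    exact ⟨w - c, by simpa [dist_eq_norm] using hw, by ring⟩

/-! ### Exhaustion by Jordan domains -/

/-- Images of the concentric discs `ball 0 r`, `r < 1`, under a conformal equivalence `φ : 𝔻 → C` are
Jordan domains inside `C` containing `φ 0`. [folklore] -/
theorem exists_jordanDomain_image_ball {C : Set ℂ} (φ : ConformalEquiv (ball (0 : ℂ) 1) C)
    {r : ℝ} (hr : 0 < r) (hr1 : r < 1) :
    ∃ U : JordanDomain, U.carrier = φ '' ball 0 r := by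
  have hcl : closure (JordanDomain.disc r hr).carrier ⊆ ball (0 : ℂ) 1 := by
    rw [JordanDomain.closure_carrier_disc]
    exact closedBall_subset_ball hr1
  exact ⟨(JordanDomain.disc r hr).image φ (φ.continuousOn.mono hcl) (φ.injOn.mono hcl), rfl⟩

/-- A compact subset of the open unit disc lies in a concentric disc of radius `1 - 1/(n+2)` for some
`n`. [folklore] -/
theorem exists_subset_ball_sub_inv {K : Set ℂ} (hK : IsCompact K) (hK1 : K ⊆ ball (0 : ℂ) 1) :
    ∃ n : ℕ, K ⊆ ball (0 : ℂ) (1 - 1 / ((n : ℝ) + 2)) := by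
  obtain ⟨r', hr'1, hKr'⟩ := exists_lt_subset_ball hK.isClosed hK1
  obtain ⟨n, hn⟩ := exists_nat_gt (1 / (1 - r'))
  refine ⟨n, hKr'.trans (ball_subset_ball ?_)⟩
  have h1 : 0 < 1 - r' := by linarith
  have h2 : (0 : ℝ) < (n : ℝ) + 2 := by positivity
  rw [div_lt_iff₀ h1] at hn
  rw [le_sub_comm, div_le_iff₀ h2]
  nlinarith

/-- **Exhaustion of a bounded simply connected domain by Jordan domains** (Werner 2008, proof of
Lemma 4). For `C ⊆ ℂ` open, simply connected, bounded and `q ∈ C` there are Jordan domains `U n`,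
increasing in `n`, with carriers in `C`, all containing `q`, such that every compact `K ⊆ C` lies in
some `U n` (and then in all later ones). They are the images of the discs `ball 0 (1 - 1/(n+2))` under
a Riemann map `𝔻 → C` centred at `q`. [folklore] -/
theorem exists_jordanDomain_exhaustion {C : Set ℂ} (hCo : IsOpen C) (hsc : IsSimplyConnected C)
    (hCb : IsBounded C) {q : ℂ} (hq : q ∈ C) :
    ∃ U : ℕ → JordanDomain, (∀ n, (U n).carrier ⊆ C) ∧ (∀ m n, m ≤ n → (U m).carrier ⊆ (U n).carrier) ∧
      (∀ n, q ∈ (U n).carrier) ∧ ∀ K : Set ℂ, IsCompact K → K ⊆ C → ∃ n, ∀ m, n ≤ m → K ⊆ (U m).carrier := by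
  obtain ⟨φ, hφ⟩ := exists_conformalEquiv_ball_apply_zero hCo hsc hCb hq
  set r : ℕ → ℝ := fun n => 1 - 1 / ((n : ℝ) + 2) with hr
  have hr0 : ∀ n, 0 < r n := fun n => by
    have : (1 : ℝ) / ((n : ℝ) + 2) ≤ 1 / 2 :=
      one_div_le_one_div_of_le (by norm_num) (by linarith [n.cast_nonneg (α := ℝ)])
    simp only [hr]
    linarith
  have hr1 : ∀ n, r n < 1 := fun n => by
    have : (0 : ℝ) < 1 / ((n : ℝ) + 2) := by positivity
    simp only [hr]
    linarith
  have hrmono : ∀ m n, m ≤ n → r m ≤ r n := fun m n hmn => by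
    simp only [hr]
    have h1 : (0 : ℝ) < (m : ℝ) + 2 := by positivity
    have h2 : (m : ℝ) + 2 ≤ (n : ℝ) + 2 := by exact_mod_cast Nat.add_le_add_right hmn 2
    have := one_div_le_one_div_of_le h1 h2
    linarith
  choose U hU using fun n => exists_jordanDomain_image_ball φ (hr0 n) (hr1 n)
  have hmaps : MapsTo φ (ball 0 1) C := φ.mapsTo
  refine ⟨U, fun n => ?_, fun m n hmn => ?_, fun n => ?_, fun K hK hKC => ?_⟩
  · rw [hU]
    rintro _ ⟨w, hw, rfl⟩
    exact hmaps (ball_subset_ball (hr1 n).le hw)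
  · rw [hU, hU]
    exact image_mono (ball_subset_ball (hrmono m n hmn))
  · rw [hU]
    exact ⟨0, mem_ball_self (hr0 n), hφ⟩
  · -- pull `K` back to the disc, where it is compact, hence inside some `ball 0 (r n)`
    have hK' : IsCompact (φ.symm '' K) := hK.image_of_continuousOn (φ.symm.continuousOn.mono hKC)
    have hK'1 : φ.symm '' K ⊆ ball 0 1 := by
      rintro _ ⟨x, hx, rfl⟩
      exact φ.symm_mapsTo (hKC hx)
    obtain ⟨n, hn⟩ := exists_subset_ball_sub_inv hK' hK'1
    refine ⟨n, fun m hnm x hx => ?_⟩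
    rw [hU]
    refine ⟨φ.symm x, ball_subset_ball (hrmono n m hnm) (hn ⟨x, hx, rfl⟩), ?_⟩
    exact φ.apply_symm_apply (hKC hx)

end Summit.CriticalPhenomena.SAWScalingLimit.Theorems.WernerDetermination
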